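import Summits.NavierStokesRegularity.NavierStokesRegularity.Theorems.ScenarioCensusScrewBlowdownPropagation
import HarnessLib

/-!
# LINE «screw-blowdown» port, part 9/13: the `LocalPersistence` appendix (a) — Gaussian locality of the heat extension, the three-term
# split of the Oseen slice at a point, calculus of the time weights

Re-homed for the scenario census (typer seat ns-census-typer-1 g7; lead g9 RULINGS [7] 20:33Z / [8] 21:03Z / [12](b) 21:58Z: «screw-blowdown v1.8 =
version of record; `Row_A13isqT` DECIDED IN KERNEL → CANDIDATE-DECIDED member under A13 (row already TREE); typer-1 slot 3 port of record =
`ScrewBlowdown_port_v1_8.lean` bb5f719a8be448dd (stub-free)»; lead g10 RULINGS [1](b) 22:36Z / [2] 22:42Z: «port v1.9 ffe1ad3d1d25e376 = port of record (idea-crit-3 DIFF-CHECK 22:40:40Z CONFORMS); slot 4 = its S3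
appendix ADMISSIBLE after slot 3»; ref PRE-CHECKs items 13 / 15 / 20 / 27): VERBATIM PORT of ns-idea-4 LINE g12-1 «screw-blowdown» PORT copy
`pub/ideators/ns-idea-4/lines/screw-blowdown/port/ScrewBlowdown_port_v1_9.lean` sha16 ffe1ad3d1d25e376 (2890 l.; lean check rc 0, 0 sorry; = the v1.8
port copy bb5f719a8be448dd as a literal prefix — itself the v1.7 copy 674e939b7b0b34e8 + the `LocalPersistence` attack appendix `…LP` + the consequences
`localPersistence_holds` / `farPastSpreading_holds` / `linearConeLiouville_holds` / `row_A13isqT_proved` — plus the v1.9 S3 block: `vanishingBlowdownLiouville_holds`,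
`row_ArecT_proved`; parts 1–3 landed while v1.8 was the copy of record, text identical),
split for the 400-line rule into `ScenarioCensusScrewBlowdown` (§1–§3: objects, the cell `Row_A13isqT`, obligation Props, S1 PROVED) →
`…Plumbing` (§4, S2 PROVED) → `…Bridges` (§5 + v1.3) → `…Recurrent` (v1.4, `Row_ArecT`) → `…OffAxis` (v1.5 a) → `…Cone` (v1.5 b:
`farPast_linearCone_smallness_of_screw`) → `…Residual` (v1.5 c + v1.6: `LinearConeLiouville`, DSS rungs) → `…Propagation` (v1.7: FS, LP,
reductions; the three class-general tools are NOT re-declared — taken BY NAME, general `E`, from `Theorems/TypeIAncientMildForwardUniqueness.lean`,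
ns-idea-4 extract a1b589f6dec7da83, p671177) → `…LPTools` / `…LPDuhamel` / `…LP` (the appendix: Gaussian locality, the three-term Oseen split,
time weights; `duhamel_bound`; the bootstrap `one_step` / `persist` / `localPersistence` + the consequences incl. `row_A13isqT_proved`) →
`…Vanishing` (v1.9: S3 proved, `row_ArecT_proved`) → `…Keys` (census keys `Row_A13isqT` / `Row_ArecT` + `_excluded`).  Lean text VERBATIM in namespaces `…Theorems.ScenarioCensus.ScrewBlowdown` / `…ScrewBlowdownLP` (the line's
`…Lines.ScrewBlowdownPort` / `…PortLP` re-homed; qualified references renamed accordingly); port edits: `local notation "E3"` → `abbrev E3` (the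
appendix `open`s it), `@[conjecture]` on `VanishingBlowdownLiouville` only (part 1 landed while S3 was open; an obligation node, now with the closed
witness `vanishingBlowdownLiouville_holds`), seven one-line docstrings added, `continuous_rotZ_angle'` not re-declared (it restates the tree's
`Literature.Analysis.FluidPDE.continuous_rotZ_angle`, gate lint `dedup.landed`; its uses renamed), the line's `set_option linter.unusedVariables false` dropped (five proof lambdas
bind the unused `θ₀ h` as `_ _`; the unused hypothesis binders of `hasVanishingBlowdown_of_axiallyRecurrent` / `pointwise_small_of_zoom_small` are spelled `_hu` / `_hΛ`,
statements otherwise identical); `set_option maxHeartbeats … in` of the appendix kept as in the line.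

No census VALUE is moved by this file (row A13 is TREE already; the lead books the member A13isq-T); NS regularity is NOT proved; (L′)
`SymmetryModuliCount.TypeIAncientLiouville` is untouched (hypothesis of bridges only); no summit statement is proved by this file.
-/

-- the summit and its single problem share the name `NavierStokesRegularity` (D-0017 nested layout)
set_option linter.dupNamespace false

open MeasureTheory Filter Topology Real Set Metric
open Literature.Analysis Literature.Analysis.FluidPDE Literature.Analysis.UnboundedOperators

namespace Summit.NavierStokesRegularity.NavierStokesRegularity.Theorems.ScenarioCensus.ScrewBlowdownLP

noncomputable section

open Summit.NavierStokesRegularity.NavierStokesRegularity.Theorems.ScenarioCensus.ScrewBlowdown (E3)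

section Gaussian

variable {E : Type*} [NormedAddCommGroup E] [InnerProductSpace ℝ E] [FiniteDimensional ℝ E]
  [MeasurableSpace E] [BorelSpace E]
variable {F : Type*} [NormedAddCommGroup F] [NormedSpace ℝ F]

omit [FiniteDimensional ℝ E] [MeasurableSpace E] [BorelSpace E] in
/-- Gaussian tilt: `G_τ(y) · e^{‖y‖²/(8τ)} = 2^{d/2} · G_{2τ}(y)`. -/
theorem heatKernel_mul_exp_normSq_div {τ : ℝ} (hτ : 0 < τ) (y : E) :
    heatKernel τ y * Real.exp (‖y‖ ^ 2 / (8 * τ)) =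
      (2 : ℝ) ^ ((Module.finrank ℝ E : ℝ) / 2) * heatKernel (2 * τ) y := by
  unfold heatKernel
  set d : ℝ := (Module.finrank ℝ E : ℝ) with hd
  have h1 : (4 * π * (2 * τ)) = 2 * (4 * π * τ) := by ring
  have h4 : (2 * (4 * π * τ)) ^ (-d / 2) = (2 : ℝ) ^ (-d / 2) * (4 * π * τ) ^ (-d / 2) :=
    Real.mul_rpow (by norm_num) (by positivity)
  have h2 : -‖y‖ ^ 2 / (4 * τ) + ‖y‖ ^ 2 / (8 * τ) = -‖y‖ ^ 2 / (4 * (2 * τ)) := by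
    field_simp; ring
  have h3 : (2 : ℝ) ^ (d / 2) * (2 : ℝ) ^ (-d / 2) = 1 := by
    rw [← Real.rpow_add (by norm_num : (0 : ℝ) < 2)]
    have : d / 2 + -d / 2 = 0 := by ring
    rw [this, Real.rpow_zero]
  rw [h1, h4, mul_assoc ((4 * π * τ) ^ (-d / 2)), ← Real.exp_add, h2]
  calc (4 * π * τ) ^ (-d / 2) * Real.exp (-‖y‖ ^ 2 / (4 * (2 * τ)))
      = ((2 : ℝ) ^ (d / 2) * (2 : ℝ) ^ (-d / 2)) *
          ((4 * π * τ) ^ (-d / 2) * Real.exp (-‖y‖ ^ 2 / (4 * (2 * τ)))) := by rw [h3, one_mul]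
    _ = (2 : ℝ) ^ (d / 2) * ((2 : ℝ) ^ (-d / 2) * (4 * π * τ) ^ (-d / 2) *
          Real.exp (-‖y‖ ^ 2 / (4 * (2 * τ)))) := by ring

/-- **Gaussian locality of the heat semigroup**: if `‖f‖ ≤ M` everywhere and `‖f‖ ≤ A` on the ball `B(x, R)`, then
`‖e^{τΔ} f (x)‖ ≤ A + 2^{d/2} M e^{−R²/(8τ)}`. -/
theorem norm_heatExtension_le_of_ball {f : E → F} {x : E} {A M R τ : ℝ} (hτ : 0 < τ) (hA : 0 ≤ A)
    (hM : 0 ≤ M) (hR : 0 ≤ R) (hfM : ∀ z, ‖f z‖ ≤ M) (hfA : ∀ y, ‖y‖ ≤ R → ‖f (x - y)‖ ≤ A) :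
    ‖heatExtension f τ x‖ ≤ A + (2 : ℝ) ^ ((Module.finrank ℝ E : ℝ) / 2) * M * Real.exp (-(R ^ 2 / (8 * τ))) := by
  rw [heatExtension_apply]
  set K : ℝ := (2 : ℝ) ^ ((Module.finrank ℝ E : ℝ) / 2) with hK
  have hK0 : 0 < K := by rw [hK]; positivity
  have h2τ : 0 < 2 * τ := by positivity
  have hI1 : Integrable (fun y => heatKernel τ y * A) (volume : Measure E) :=
    (integrable_heatKernel_holds hτ).mul_const A
  have hI2 : Integrable (fun y => M * Real.exp (-(R ^ 2 / (8 * τ))) * (K * heatKernel (2 * τ) y))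
      (volume : Measure E) :=
    ((integrable_heatKernel_holds h2τ).const_mul K).const_mul _
  have hint := hI1.add hI2
  calc ‖∫ y, heatKernel τ y • f (x - y)‖
      ≤ ∫ y, (heatKernel τ y * A + M * Real.exp (-(R ^ 2 / (8 * τ))) * (K * heatKernel (2 * τ) y)) := by
        refine norm_integral_le_of_norm_le hint (Eventually.of_forall fun y => ?_)
        rw [norm_smul, Real.norm_of_nonneg (heatKernel_pos hτ y).le]
        have hG : 0 ≤ heatKernel τ y := (heatKernel_pos hτ y).le
        have hG2 : 0 ≤ heatKernel (2 * τ) y := (heatKernel_pos h2τ y).le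
        have hsecond : 0 ≤ M * Real.exp (-(R ^ 2 / (8 * τ))) * (K * heatKernel (2 * τ) y) := by positivity
        by_cases hy : ‖y‖ ≤ R
        · calc heatKernel τ y * ‖f (x - y)‖ ≤ heatKernel τ y * A := mul_le_mul_of_nonneg_left (hfA y hy) hG
            _ ≤ _ := le_add_of_nonneg_right hsecond
        · push Not at hy
          have hRy : R ^ 2 ≤ ‖y‖ ^ 2 := pow_le_pow_left₀ hR hy.le 2
          have hexp : 1 ≤ Real.exp (‖y‖ ^ 2 / (8 * τ)) * Real.exp (-(R ^ 2 / (8 * τ))) := by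
            rw [← Real.exp_add]
            apply Real.one_le_exp
            have : R ^ 2 / (8 * τ) ≤ ‖y‖ ^ 2 / (8 * τ) := div_le_div_of_nonneg_right hRy (by positivity)
            linarith
          have htilt := heatKernel_mul_exp_normSq_div hτ y
          calc heatKernel τ y * ‖f (x - y)‖ ≤ heatKernel τ y * M := mul_le_mul_of_nonneg_left (hfM _) hG
            _ ≤ heatKernel τ y * M * (Real.exp (‖y‖ ^ 2 / (8 * τ)) * Real.exp (-(R ^ 2 / (8 * τ)))) :=
                le_mul_of_one_le_right (by positivity) hexp
            _ = M * Real.exp (-(R ^ 2 / (8 * τ))) * (heatKernel τ y * Real.exp (‖y‖ ^ 2 / (8 * τ))) := by ring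
            _ = M * Real.exp (-(R ^ 2 / (8 * τ))) * (K * heatKernel (2 * τ) y) := by rw [htilt]
            _ ≤ _ := le_add_of_nonneg_left (by positivity)
    _ = A + K * M * Real.exp (-(R ^ 2 / (8 * τ))) := by
        rw [integral_add hI1 hI2, integral_mul_const, integral_const_mul, integral_const_mul,
          integral_heatKernel_eq_one_holds hτ, integral_heatKernel_eq_one_holds h2τ]
        ring

end Gaussian

/-! ## §1 The three-term split of the Oseen slice at a point -/

section Slice

variable {E : Type*} [NormedAddCommGroup E] [InnerProductSpace ℝ E] [FiniteDimensional ℝ E]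
  [MeasurableSpace E] [BorelSpace E]

/-- **Mixed slice bound.** There are `C₀, C₁ > 0` (the tree's near and far slice constants) such that for `σ > 0`,
a.e.-strongly measurable fields `a, b` with global bounds `‖a‖ ≤ M_a`, `‖b‖ ≤ M_b`, and LOCAL bounds `‖a z‖ ≤ m_a`,
`‖b z‖ ≤ m_b` for `‖x − z‖ < r` (`r > 0`, `0 ≤ m_a ≤ M_a`, `0 ≤ m_b`):
`‖N_σ[a,b](x)‖ ≤ C₀ σ^{-1/2} m_a m_b + 2 C₁ M_a M_b / r`
(split `a = a 1_B + a 1_{Bᶜ}`, `b = b 1_B + b 1_{Bᶜ}`, `B = B(x,r)`: near×near by the near bound, the two terms with an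
exterior factor by the far-field bound). -/
theorem exists_norm_oseenSlice_le_mixed :
    ∃ C₁ : ℝ, 0 < C₁ ∧ ∀ {σ : ℝ}, 0 < σ → ∀ {a b : E → E},
      AEStronglyMeasurable a volume → AEStronglyMeasurable b volume →
      ∀ {Ma Mb ma mb : ℝ} {x : E} {r : ℝ}, 0 < r → 0 ≤ ma → ma ≤ Ma → 0 ≤ mb →
      (∀ z, ‖a z‖ ≤ Ma) → (∀ z, ‖b z‖ ≤ Mb) →
      (∀ z, ‖x - z‖ < r → ‖a z‖ ≤ ma) → (∀ z, ‖x - z‖ < r → ‖b z‖ ≤ mb) →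
        ‖oseenSlice σ a b x‖ ≤ oseenSliceConst E * σ ^ (-(1 / 2 : ℝ)) * ma * mb + 2 * (C₁ * Ma * Mb / r) := by
  obtain ⟨C₁, hC₁, hfar⟩ := exists_norm_oseenSlice_le_of_far (E := E)
  refine ⟨C₁, hC₁, ?_⟩
  intro σ hσ a b ham hbm Ma Mb ma mb x r hr hma hmaM hmb haM hbM ham' hbm'
  have hMb : 0 ≤ Mb := (norm_nonneg _).trans (hbM x)
  -- the ball and the four pieces
  set B : Set E := Metric.ball x r with hB
  have hBm : MeasurableSet B := measurableSet_ball
  have hmemB : ∀ z, z ∈ B ↔ ‖x - z‖ < r := fun z => by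
    rw [hB, Metric.mem_ball, dist_eq_norm, ← norm_neg, neg_sub]
  set aI : E → E := B.indicator a with haI
  set aO : E → E := Bᶜ.indicator a with haO
  set bI : E → E := B.indicator b with hbI
  set bO : E → E := Bᶜ.indicator b with hbO
  have ha_split : a = aI + aO := by rw [haI, haO, Set.indicator_self_add_compl]
  have hb_split : b = bI + bO := by rw [hbI, hbO, Set.indicator_self_add_compl]
  -- bounds on the pieces
  have nI : ∀ (f : E → E) (S : Set E) (z : E), ‖S.indicator f z‖ ≤ ‖f z‖ := fun f S z =>
    norm_indicator_le_norm_self _ _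
  have haI_m : ∀ z, ‖aI z‖ ≤ ma := by
    intro z
    by_cases hz : z ∈ B
    · rw [haI, Set.indicator_of_mem hz]; exact ham' z ((hmemB z).1 hz)
    · rw [haI, Set.indicator_of_notMem hz, norm_zero]; exact hma
  have haI_M : ∀ z, ‖aI z‖ ≤ Ma := fun z => (haI_m z).trans hmaM
  have hbI_m : ∀ z, ‖bI z‖ ≤ mb := by
    intro z
    by_cases hz : z ∈ B
    · rw [hbI, Set.indicator_of_mem hz]; exact hbm' z ((hmemB z).1 hz)
    · rw [hbI, Set.indicator_of_notMem hz, norm_zero]; exact hmb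
  have haO_M : ∀ z, ‖aO z‖ ≤ Ma := fun z => (nI a _ z).trans (haM z)
  have hbO_M : ∀ z, ‖bO z‖ ≤ Mb := fun z => (nI b _ z).trans (hbM z)
  have hnc : ∀ z, ‖x - z‖ < r → z ∉ Bᶜ := fun z hz => by
    rw [Set.mem_compl_iff, not_not]; exact (hmemB z).2 hz
  have haO_zero : ∀ z, ‖x - z‖ < r → aO z = 0 := fun z hz => by
    rw [haO, Set.indicator_of_notMem (hnc z hz)]
  have hbO_zero : ∀ z, ‖x - z‖ < r → bO z = 0 := fun z hz => by
    rw [hbO, Set.indicator_of_notMem (hnc z hz)]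
  -- measurability / integrability of the slice integrands
  have maI : AEStronglyMeasurable aI volume := ham.indicator hBm
  have maO : AEStronglyMeasurable aO volume := ham.indicator hBm.compl
  have mbI : AEStronglyMeasurable bI volume := hbm.indicator hBm
  have mbO : AEStronglyMeasurable bO volume := hbm.indicator hBm.compl
  have iII := integrable_oseenKernel_slice_of_bound hσ maI mbI haI_M hbI_m x
  have iIO := integrable_oseenKernel_slice_of_bound hσ maI mbO haI_M hbO_M x
  have iIb : Integrable (fun y => oseenKernel σ (x - y) (aI y) (b y)) volume := by
    have := integrable_oseenKernel_slice_of_bound hσ maI hbm haI_M hbM x; exact this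
  have iOb := integrable_oseenKernel_slice_of_bound hσ maO hbm haO_M hbM x
  -- the split `N[a,b] = N[aI,bI] + N[aI,bO] + N[aO,b]`
  have hsplit : oseenSlice σ a b x =
      oseenSlice σ aI bI x + oseenSlice σ aI bO x + oseenSlice σ aO b x := by
    conv_lhs => rw [ha_split]
    rw [oseenSlice_add_left iIb iOb]
    conv_lhs => arg 1; rw [hb_split]
    rw [oseenSlice_add_right iII iIO]
  -- the three bounds
  have h1 : ‖oseenSlice σ aI bI x‖ ≤ oseenSliceConst E * σ ^ (-(1 / 2 : ℝ)) * ma * mb :=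
    norm_oseenSlice_le_oseenSliceConst hσ haI_m hbI_m x
  have h2 : ‖oseenSlice σ aI bO x‖ ≤ C₁ * Ma * Mb / r :=
    hfar hσ haI_M hbO_M hr fun z hz => Or.inr (hbO_zero z hz)
  have h3 : ‖oseenSlice σ aO b x‖ ≤ C₁ * Ma * Mb / r :=
    hfar hσ haO_M hbM hr fun z hz => Or.inl (haO_zero z hz)
  rw [hsplit]
  calc ‖oseenSlice σ aI bI x + oseenSlice σ aI bO x + oseenSlice σ aO b x‖
      ≤ ‖oseenSlice σ aI bI x‖ + ‖oseenSlice σ aI bO x‖ + ‖oseenSlice σ aO b x‖ := norm_add₃_le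
    _ ≤ _ := by linarith

end Slice

/-! ## §2 Calculus of the time weights -/

/-- `∫_{(a,b)} (−τ)^{−3/2} dτ = 2/√(−b) − 2/√(−a) ≤ 2/√(−b)` for `a ≤ b < 0` (FTC for `τ ↦ 2(−τ)^{−1/2}`). -/
theorem setIntegral_neg_rpow_three_halves {a b : ℝ} (hab : a ≤ b) (hb : b < 0) :
    IntegrableOn (fun τ : ℝ => (-τ) ^ (-(3 / 2 : ℝ))) (Ioo a b) ∧
      ∫ τ in Ioo a b, (-τ) ^ (-(3 / 2 : ℝ)) ≤ 2 / Real.sqrt (-b) := by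
  -- continuity on `[a, b] ⊂ (−∞, 0)`
  have hcont : ContinuousOn (fun τ : ℝ => (-τ) ^ (-(3 / 2 : ℝ))) (Icc a b) := by
    refine ContinuousOn.rpow_const (continuous_neg.continuousOn) fun τ hτ => Or.inl ?_
    exact (show 0 < -τ by linarith [hτ.2]).ne'
  have hint : IntegrableOn (fun τ : ℝ => (-τ) ^ (-(3 / 2 : ℝ))) (Ioo a b) :=
    (hcont.integrableOn_compact isCompact_Icc).mono_set Ioo_subset_Icc_self
  refine ⟨hint, ?_⟩
  -- the antiderivative `F τ = 2 (−τ)^{−1/2}`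
  have hderiv : ∀ τ ∈ Ioo a b, HasDerivAt (fun τ : ℝ => 2 * (-τ) ^ (-(1 / 2 : ℝ)))
      ((-τ) ^ (-(3 / 2 : ℝ))) τ := by
    intro τ hτ
    have hτ0 : 0 < -τ := by linarith [hτ.2]
    have h1 : HasDerivAt (fun τ : ℝ => -τ) (-1) τ := hasDerivAt_neg τ
    have h2 := h1.rpow_const (p := -(1 / 2 : ℝ)) (Or.inl hτ0.ne')
    have h3 := h2.const_mul (2 : ℝ)
    have e : 2 * (-1 * -(1 / 2 : ℝ) * (-τ) ^ (-(1 / 2 : ℝ) - 1)) = (-τ) ^ (-(3 / 2 : ℝ)) := by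
      rw [show (-(1 / 2 : ℝ) - 1) = -(3 / 2 : ℝ) by norm_num]; ring
    rw [e] at h3
    exact h3
  have hFcont : ContinuousOn (fun τ : ℝ => 2 * (-τ) ^ (-(1 / 2 : ℝ))) (Icc a b) := by
    refine ContinuousOn.mul continuousOn_const ?_
    refine ContinuousOn.rpow_const (continuous_neg.continuousOn) fun τ hτ => Or.inl ?_
    exact (show 0 < -τ by linarith [hτ.2]).ne'
  have hFTC := intervalIntegral.integral_eq_sub_of_hasDerivAt_of_le hab hFcont hderiv
    (hcont.intervalIntegrable_of_Icc hab)
  rw [← integral_Ioc_eq_integral_Ioo, ← intervalIntegral.integral_of_le hab, hFTC]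
  have ha0 : 0 < -a := by linarith
  have hb0 : 0 < -b := by linarith
  have e1 : (-b) ^ (-(1 / 2 : ℝ)) = 1 / Real.sqrt (-b) := by
    rw [Real.rpow_neg hb0.le, Real.sqrt_eq_rpow, one_div]
    norm_num
  have e2 : 0 ≤ (-a) ^ (-(1 / 2 : ℝ)) := Real.rpow_nonneg ha0.le _
  rw [e1]
  have : 2 * (1 / Real.sqrt (-b)) = 2 / Real.sqrt (-b) := by ring
  linarith

/-- The far-field GAP: for `0 < q ≤ 1`, `0 < −σ` and `−τ ≥ (1+q²)(−σ)`, `√(−τ) − √(−σ) ≥ q²√(−τ)/4`. -/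
theorem sqrt_gap {q σ τ : ℝ} (hq : 0 < q) (hq1 : q ≤ 1) (hσ : σ < 0) (hτ : (1 + q ^ 2) * (-σ) ≤ -τ) :
    q ^ 2 * Real.sqrt (-τ) / 4 ≤ Real.sqrt (-τ) - Real.sqrt (-σ) := by
  have hσ0 : 0 < -σ := by linarith
  have hτ0 : 0 < -τ := lt_of_lt_of_le (by positivity) hτ
  set w := Real.sqrt (-τ) with hw
  set p := Real.sqrt (-σ) with hp
  have hw0 : 0 < w := Real.sqrt_pos.2 hτ0
  have hp0 : 0 ≤ p := Real.sqrt_nonneg _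
  have hw2 : w ^ 2 = -τ := Real.sq_sqrt hτ0.le
  have hp2 : p ^ 2 = -σ := Real.sq_sqrt hσ0.le
  -- `(1+q²) p² ≤ w²` and `(1+q²)(1 − q²/4)² ≥ 1`
  have h1 : (1 + q ^ 2) * p ^ 2 ≤ w ^ 2 := by rw [hw2, hp2]; exact hτ
  have hq2 : q ^ 2 ≤ 1 := by nlinarith
  have hpoly : 1 ≤ (1 + q ^ 2) * (1 - q ^ 2 / 4) ^ 2 := by nlinarith [sq_nonneg q, sq_nonneg (q ^ 2)]
  -- `p ≤ w (1 − q²/4)`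
  have h14 : 0 < 1 - q ^ 2 / 4 := by nlinarith
  have h2 : p ^ 2 ≤ (w * (1 - q ^ 2 / 4)) ^ 2 := by
    have : p ^ 2 * 1 ≤ p ^ 2 * ((1 + q ^ 2) * (1 - q ^ 2 / 4) ^ 2) :=
      mul_le_mul_of_nonneg_left hpoly (sq_nonneg p)
    nlinarith [h1, sq_nonneg (1 - q ^ 2 / 4)]
  have h3 : p ≤ w * (1 - q ^ 2 / 4) := by
    have := Real.sqrt_le_sqrt h2
    rwa [Real.sqrt_sq hp0, Real.sqrt_sq (by positivity)] at this
  nlinarith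

/-- `∫_{(a,b)} 1_{(c,∞)}(τ) (b − τ)^{−1/2} dτ ≤ 2 √(b − c)` for `c < b` (the indicator cuts the range to `(max a c, b)`). -/
theorem setIntegral_indicator_sub_rpow_le {a b c : ℝ} (hcb : c < b) :
    IntegrableOn (fun τ : ℝ => (Ioi c).indicator (fun τ => (b - τ) ^ (-(1 / 2 : ℝ))) τ) (Ioo a b) ∧
      ∫ τ in Ioo a b, (Ioi c).indicator (fun τ => (b - τ) ^ (-(1 / 2 : ℝ))) τ ≤ 2 * Real.sqrt (b - c) := by
  have hint : IntegrableOn (fun τ : ℝ => (b - τ) ^ (-(1 / 2 : ℝ))) (Ioo a b) :=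
    integrableOn_sub_rpow_Ioo (by norm_num)
  refine ⟨hint.indicator measurableSet_Ioi, ?_⟩
  rw [setIntegral_indicator measurableSet_Ioi]
  have hset : Ioo a b ∩ Ioi c = Ioo (max a c) b := by
    ext τ; simp only [mem_inter_iff, mem_Ioo, mem_Ioi, max_lt_iff]; tauto
  rw [hset]
  rcases le_or_gt (max a c) b with hle | hgt
  · rw [setIntegral_Ioo_sub_rpow_neg_half hle, ← Real.sqrt_eq_rpow]
    have : Real.sqrt (b - max a c) ≤ Real.sqrt (b - c) :=
      Real.sqrt_le_sqrt (by linarith [le_max_right a c])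
    linarith
  · rw [Ioo_eq_empty (not_lt.2 hgt.le), Measure.restrict_empty, integral_zero_measure]
    positivity

end

end Summit.NavierStokesRegularity.NavierStokesRegularity.Theorems.ScenarioCensus.ScrewBlowdownLP
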